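import Summits.QuantumFields.YangMills.Theorems.DiagonalMirrorRPRWilsonDiagonalModelNatKernel
import Mathlib.Analysis.Normed.Ring.InfiniteSum

/-!
# Crux `DiagonalMirrorRPR` (stmt-QuantumFields-10604), line `sign-twisted-diagonal-trace`, construction F1_diag
# (director-ym O4 WORD 3 (A)), operator layer, step S4 (first brick): the m-fold FEATURE RESUMMATION
# `Σ_{k⃗ ∈ ℕ^m} ∏_t ψ_{k_t}(a_t) ψ_{k_t}(b_t) = ∏_t exp(β⟨a_t, b_t⟩)`

Helper for the crux `DiagonalMirrorRPR` of `YangMills` (routes `IsotropyFromPowerCounting`, `MirrorModularBoosts`,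
`PencilRigidity`; item stmt-QuantumFields-10604), attached `--supports … --as helper`; it closes nothing by itself.
Continuation of `…WilsonDiagonalModelNatKernel` (ℕ-indexed features `natFeature`, `hasSum_natFeature_mul`).  This is the pointwise
identity behind the trace formula `Σ_i κ_i^m = diagCyclicTraceU ρ β m` (ROADMAP-F1diag v3 §1¾ (S4c)): along a cycle of `m`
diagonal steps, summing the `m` feature indices of the lifted kernels `𝔞((k_t, X_t), (k_{t+1}, X_{t+1}))` folds each pair of
features back into the Θ-twisted even weight `exp(β⟨w(ΘY_t), w(Y_{t−1})⟩)` (`hasSum_expFeature_even`), i.e. back onto the cyclic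
chain of the two-step kernel `K_u`.

* `hasSum_pi_prod_and_summable_norm`, **`hasSum_pi_prod`** — finite products of ABSOLUTELY convergent real series:
  `Σ_{k ∈ ℕ^m} ∏_t f_t(k_t) = ∏_t c_t` (induction via `Fin.consEquiv` and Mathlib's `HasSum.mul` /
  `summable_mul_of_summable_norm`);
* `abs_expFeature_mul_expFeature`, `summable_abs_expFeature_mul_expFeature`, `summable_norm_natFeature_mul` (the feature products
  are absolutely summable);
* ★ **`hasSum_pi_prod_natFeature_mul`** — `HasSum (k⃗ ↦ ∏_t ψ_{k_t}(a_t) ψ_{k_t}(b_t)) (∏_t exp(β Σ_j a_{t j} b_{t j}))` for `β ≥ 0`.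

OWED (S4 remainder): kernels of powers of `𝔄` as iterated `L²` kernels, the HS-pairing form `Σ κ^m = ∫ 𝔞·𝔞^{(m−1)}`
(`Literature…L2KernelPairing`), and Tonelli on `count^m × Haar^m` turning the cyclic `𝔞`-integral into `diagCyclicTraceU ρ β m` with
this file's resummation; then (S5) spectral extraction and (P) the pairing layer — no `def wilsonDiagonalModel` yet.
HONEST FRAMING: a construction helper; nothing about D_old ⟨10604⟩, the RP crux of the FOLD restate, or the summit is proved;
the Yang–Mills mass gap is NOT proved here or anywhere in the tree.
-/

set_option autoImplicit false

noncomputable section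

open scoped BigOperators

namespace Summit.QuantumFields.YangMills.Cruxes.DiagonalMirrorRPR.SignTwistedDiagonalTrace.WilsonDiagonal

/-! ## §18 Finite products of absolutely convergent real series: `Σ_{k ∈ ℕ^m} ∏_t f_t(k_t) = ∏_t Σ_k f_t(k)` -/

section PiProd

/-- **Finite products of absolutely convergent series** (induction on the number of factors via `Equiv.piFinSucc` and
`HasSum.mul`): if each `f t` is absolutely summable with sum `c t`, then `k ↦ ∏_t f_t(k_t)` on `Fin m → ℕ` is absolutely summable
with sum `∏_t c_t`. -/
theorem hasSum_pi_prod_and_summable_norm :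
    ∀ (m : ℕ) (f : Fin m → ℕ → ℝ) (c : Fin m → ℝ), (∀ t, HasSum (f t) (c t)) → (∀ t, Summable fun k => ‖f t k‖) →
      HasSum (fun k : Fin m → ℕ => ∏ t, f t (k t)) (∏ t, c t) ∧ Summable fun k : Fin m → ℕ => ‖∏ t, f t (k t)‖ := by
  intro m
  induction m with
  | zero =>
    intro f c _ _
    refine ⟨?_, ?_⟩
    · have h0 : (∏ t : Fin 0, c t) = ∑ k : Fin 0 → ℕ, ∏ t : Fin 0, f t (k t) := by simp
      rw [h0]
      exact hasSum_fintype _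
    · exact (hasSum_fintype _).summable
  | succ m ih =>
    intro f c hf hn
    obtain ⟨ihs, ihn⟩ := ih (fun t => f t.succ) (fun t => c t.succ) (fun t => hf t.succ) (fun t => hn t.succ)
    -- transport along `ℕ × (Fin m → ℕ) ≃ (Fin (m+1) → ℕ)` (`Fin.cons`)
    let e : ℕ × (Fin m → ℕ) ≃ (Fin (m + 1) → ℕ) := Fin.consEquiv fun _ : Fin (m + 1) => ℕ
    have hfun : (fun k : Fin (m + 1) → ℕ => ∏ t, f t (k t)) ∘ e =
        fun q : ℕ × (Fin m → ℕ) => f 0 q.1 * ∏ t : Fin m, f t.succ (q.2 t) := by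
      funext q
      simp only [Function.comp, e, Fin.consEquiv, Equiv.coe_fn_mk, Fin.prod_univ_succ, Fin.cons_zero, Fin.cons_succ]
    have hnfun : (fun k : Fin (m + 1) → ℕ => ‖∏ t, f t (k t)‖) ∘ e =
        fun q : ℕ × (Fin m → ℕ) => ‖f 0 q.1‖ * ‖∏ t : Fin m, f t.succ (q.2 t)‖ := by
      funext q
      simp only [Function.comp, e, Fin.consEquiv, Equiv.coe_fn_mk, Fin.prod_univ_succ, Fin.cons_zero, Fin.cons_succ,
        norm_mul]
    -- the product family is (absolutely) summable
    have hsum : Summable fun q : ℕ × (Fin m → ℕ) => f 0 q.1 * ∏ t : Fin m, f t.succ (q.2 t) :=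
      summable_mul_of_summable_norm (f := f 0) (g := fun k' : Fin m → ℕ => ∏ t : Fin m, f t.succ (k' t)) (hn 0) ihn
    have hn0' : Summable fun k : ℕ => ‖‖f 0 k‖‖ := by simpa only [norm_norm] using hn 0
    have ihn' : Summable fun k' : Fin m → ℕ => ‖‖∏ t : Fin m, f t.succ (k' t)‖‖ := by simpa only [norm_norm] using ihn
    have hnsum : Summable fun q : ℕ × (Fin m → ℕ) => ‖f 0 q.1‖ * ‖∏ t : Fin m, f t.succ (q.2 t)‖ :=
      summable_mul_of_summable_norm (f := fun k : ℕ => ‖f 0 k‖) (g := fun k' : Fin m → ℕ => ‖∏ t : Fin m, f t.succ (k' t)‖)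
        hn0' ihn'
    have h2 : HasSum (fun q : ℕ × (Fin m → ℕ) => f 0 q.1 * ∏ t : Fin m, f t.succ (q.2 t)) (c 0 * ∏ t : Fin m, c t.succ) :=
      HasSum.mul (f := f 0) (g := fun k' : Fin m → ℕ => ∏ t : Fin m, f t.succ (k' t)) (hf 0) ihs hsum
    refine ⟨?_, ?_⟩
    · rw [Fin.prod_univ_succ, ← e.hasSum_iff, hfun]
      exact h2
    · rw [← e.summable_iff, hnfun]
      exact hnsum

/-- `Σ_{k ∈ ℕ^m} ∏_t f_t(k_t) = ∏_t c_t` for absolutely summable real series `Σ_k f_t(k) = c_t`. -/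
theorem hasSum_pi_prod {m : ℕ} {f : Fin m → ℕ → ℝ} {c : Fin m → ℝ} (hf : ∀ t, HasSum (f t) (c t))
    (hn : ∀ t, Summable fun k => ‖f t k‖) :
    HasSum (fun k : Fin m → ℕ => ∏ t, f t (k t)) (∏ t, c t) :=
  (hasSum_pi_prod_and_summable_norm m f c hf hn).1

end PiProd

/-! ## §19 The m-fold feature resummation `Σ_{k⃗} ∏_t ψ_{k_t}(a_t) ψ_{k_t}(b_t) = ∏_t exp(β⟨a_t, b_t⟩)` -/

section FeatureResum

variable {p : ℕ}

/-- `|φ_q(a) φ_q(b)| = φ_q(|a|) φ_q(|b|)` (`β ≥ 0`). -/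
theorem abs_expFeature_mul_expFeature {β : ℝ} (hβ : 0 ≤ β) (q : ExpIdx p) (a b : Fin p → ℝ) :
    |expFeature β q a * expFeature β q b| = expFeature β q (fun j => |a j|) * expFeature β q (fun j => |b j|) := by
  rw [expFeature_mul_expFeature hβ, expFeature_mul_expFeature hβ, abs_mul, abs_mul, abs_of_nonneg (by positivity),
    Finset.abs_prod, Finset.abs_prod]

/-- The feature products are ABSOLUTELY summable. -/
theorem summable_abs_expFeature_mul_expFeature {β : ℝ} (hβ : 0 ≤ β) (a b : Fin p → ℝ) :
    Summable fun q : ExpIdx p => |expFeature β q a * expFeature β q b| := by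
  simp only [abs_expFeature_mul_expFeature hβ]
  exact summable_expFeature_mul_expFeature hβ _ _

/-- The ℕ-indexed feature products are absolutely summable. -/
theorem summable_norm_natFeature_mul {β : ℝ} (hβ : 0 ≤ β) (a b : Fin p → ℝ) :
    Summable fun k : ℕ => ‖natFeature β k a * natFeature β k b‖ := by
  have h : (fun k : ℕ => ‖natFeature β k a * natFeature β k b‖) =
      Function.extend (idxEmb p) (fun q => |expFeature β q a * expFeature β q b|) 0 := by
    funext k
    rw [Real.norm_eq_abs, show natFeature β k a * natFeature β k b =
      Function.extend (idxEmb p) (fun q => expFeature β q a * expFeature β q b) 0 k from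
        congrFun (natFeature_mul_eq_extend β a b) k]
    by_cases hk : ∃ q, idxEmb p q = k
    · obtain ⟨q, rfl⟩ := hk
      rw [(idxEmb_injective p).extend_apply, (idxEmb_injective p).extend_apply]
    · rw [Function.extend_apply' _ _ _ hk, Function.extend_apply' _ _ _ hk, Pi.zero_apply, abs_zero]
  rw [h, summable_extend_zero (idxEmb_injective p)]
  exact summable_abs_expFeature_mul_expFeature hβ a b

/-- ★ **The m-fold feature resummation**: `Σ_{k ∈ ℕ^m} ∏_t ψ_{k_t}(a_t) ψ_{k_t}(b_t) = ∏_t exp(β⟨a_t, b_t⟩)` (`β ≥ 0`) — the identity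
that folds the cyclic integral of the lifted kernel `𝔞` back onto the cyclic chain of the two-step kernel `K_u` (trace formula,
OWED). -/
theorem hasSum_pi_prod_natFeature_mul {β : ℝ} (hβ : 0 ≤ β) {m : ℕ} (a b : Fin m → Fin p → ℝ) :
    HasSum (fun k : Fin m → ℕ => ∏ t, natFeature β (k t) (a t) * natFeature β (k t) (b t))
      (∏ t, Real.exp (β * ∑ j, a t j * b t j)) :=
  hasSum_pi_prod (f := fun t k => natFeature β k (a t) * natFeature β k (b t))
    (fun t => hasSum_natFeature_mul hβ (a t) (b t)) (fun t => summable_norm_natFeature_mul hβ (a t) (b t))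

end FeatureResum

end Summit.QuantumFields.YangMills.Cruxes.DiagonalMirrorRPR.SignTwistedDiagonalTrace.WilsonDiagonal

end
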